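/-
Copyright (c) 2026 the pub-hodgecm-mathlib formalisation cell (harness21).  Prover seat hodgecm-mathlib-K2E4-p10 (g4), Track B ∕ K2-LIT, h413 =
`stmt-HodgeConjecture-24833`, line `K2_E1_TraceFormulaBeta`, campaign «EIS-RANK-ONE» rung R6j («BRACKET CONTINUITY», DEAL of the dealer K2E1-plan (g4) 2026-09-04T06:47:30Z
under RULING «VAC-B»): the intertwined coefficient `φ̃_z(g) = (∫_{N(𝔸)} f_z(w₀ v g) dν)·H(g)^{z−2}` of `U(2,1)` is CONTINUOUS IN `z` and UNIFORMLY BOUNDED on half-planes `Re z ≥ σ₁ > 2`,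
and the Maass–Selberg brackets built from it move continuously in `z` — the `hB₂`∕`hB₄`∕`hR` inputs of the pole-control junction ★ p858014∕p858019.
-/
import Summits.HodgeConjecture.HodgeConjecture.Theorems.K2E1MaassSelbergCMThreeFinal      -- ★ p857941 (K2E4-p14 g5): the CM road to `hfin` (★ `hfin_of_locallyUniformMajorant` ∘ ★ R4a majorant); imports ★ [D8] p857898
import Summits.HodgeConjecture.HodgeConjecture.Theorems.K2E1BorelHeightWeylUnipotent        -- ★ R6a: `borelHeight_weylLongU_coe_mul_mul_borelHeight_le_one` (`H(w₀ v g)·H(g) ≤ 1`)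
import Summits.HodgeConjecture.HodgeConjecture.Theorems.K2E1MaassSelbergDiagonalCMThree      -- ★ p857918 (this seat): `continuousWithinAt_integral_mul_conj_of_bound` (the `K_U` layer)
import HarnessLib

/-!
# K2·E1 — `K2E1IntertwinedCoeffContinuousCM`: `z ↦ φ̃_z(g)` IS CONTINUOUS ON `{Re z > 2}` AND UNIFORMLY BOUNDED ON `{Re z ≥ σ₁}`; THE BRACKETS `[Ξ](z)` MOVE CONTINUOUSLY
# (campaign «EIS-RANK-ONE», rung R6j «BRACKET CONTINUITY»: the `hB₂`∕`hB₄` (hence `hR`) inputs of the pole-control junction, by three dominated-convergence layers)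

Track B ∕ K2-LIT, crux h413 = `stmt-HodgeConjecture-24833`, route of record `HCCMUnconditional`; cell `hodgecm-mathlib`, squad K2, ENGINE E1.  Prover seat
`hodgecm-mathlib-K2E4-p10` (g4); DEAL (R6j) of the dealer K2E1-plan (g4) 2026-09-04T06:47:30Z (RULING «VAC-B»), REPORT-FIRST 06:48Z.  THEOREMS ONLY (no `def`, no `instance`,
no notation, no named-fact hypothesis, no `sorry`); lane `--supports stmt-HodgeConjecture-24833 --as helper` (count-neutral).  Closes no socket.

THE MATHEMATICS [MoeglinWaldspurger1995, II.1.6–II.1.7, IV.2.3, IV.3.12; Garrett2018, §2.8, §11.3; Arthur1980TraceFormulaII, §4].  `f_z = φ·H^z`, `‖φ‖ ≤ C_φ`.  The intertwining integral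
`I(z, g) = ∫_{N(𝔸)} f_z(w₀ v g) dν(v)` is dominated on every strip `σ₁ < Re z < σ₂` by `C_φ·(H(w₀vg)^{σ₁} + H(w₀vg)^{σ₂})` (★ `rpow_le_rpow_add_rpow`), integrable as soon as `v ↦ H(w₀vg)^σ`
is for `σ > σ₀` (★ [D8] §4 at the CM pair from Godement finiteness), and `z ↦ f_z(x)` is entire: §1 `continuousOn_intertwiningIntegral_flatSectionU_three` (dominated convergence,
Mathlib `continuousAt_of_dominated`), hence the ED. 5 INTERTWINED COEFFICIENT `φ̃_z(g) = I(z,g)·H(g)^{z−2}` is continuous on `{Re z > σ₀}` (`continuousOn_intertwinedCoeff_flatSectionU_three`).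
UNIFORM BOUND (`norm_intertwinedCoeff_le_uniform_three`): ★ [D8] §5 gives `‖φ̃_z(g)‖ ≤ C_φ·c(Re z)`, `c(σ) = ∫ H(w₀v)^σ dν`, and `c` is NON-INCREASING because `H(w₀ v) ≤ 1` (★ R6a
`borelHeight_weylLongU_coe_mul_mul_borelHeight_le_one` at `g = 1`), so `‖φ̃_z(g)‖ ≤ C_φ·c(σ₁)` for all `Re z ≥ σ₁`, all `g` — the z-UNIFORM bound the bracket layers need.  §2 the two
OUTER LAYERS, generic (any finite-measure space, any first-countable parameter space): the `K_U`-average `p ↦ ∫_K α·conj(β_p) dμ_K` (★ p857918 `continuousWithinAt_integral_mul_conj_of_bound`,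
re-exported in `K_U`-currency) and the idele-class bracket `p ↦ ∫_S ↑w·Ξ_p dν_I` over a set `S` of finite measure with a bounded real weight `w` (`‖x‖ ≤ 1` on `S = 𝓕_I ∩ {‖x‖ ≤ 1}`,
★ Tate finiteness): `continuousWithinAt_setIntegral_ofReal_mul_of_bound`.  §3 the CM pair `(L⁺, L, conj)`: `hint` DISCHARGED (★ [D8] §4 `integrable_borelHeight_weylLongU_mul_rpow` ∘ ★
`hfin_of_locallyUniformMajorant` ∘ ★ `exists_locallyUniform_majorant_flatSectionU_cm_three`, fundamental domain of COMPACT CLOSURE per «𝓕-CPT» narrowed) ⟹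
`continuousOn_intertwinedCoeff_flatSectionU_cm_three` on `{Re z > 2}` and `norm_intertwinedCoeff_le_uniform_cm_three` on `{Re z ≥ σ₁}`, `σ₁ > 2`, no named input.
HONEST LABEL: HC_CM is proved only modulo the 7 printed citations (2 remaining named inputs: hLiu418 = `stmt-HodgeConjecture-24832`, h413 = `stmt-HodgeConjecture-24833`) until rung 0
closes; this file asserts no named fact and closes no socket.
References: [MoeglinWaldspurger1995] II.1.6–II.1.7, IV.2.3, IV.3.12 · [Garrett2018] §2.8, §11.3 · [Arthur1980TraceFormulaII] §4 · [Godement1964] §1.1.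
-/

set_option autoImplicit false
-- the mandated namespace repeats the single-problem summit's segment (`HodgeConjecture.HodgeConjecture`)
set_option linter.dupNamespace false

noncomputable section

open MeasureTheory Measure NumberField IsDedekindDomain Set Filter Topology MulAction
open scoped ENNReal NNReal ComplexConjugate
open Literature.MeasureTheory.Group Literature.NumberTheory
open Literature.NumberTheory.Automorphic Literature.NumberTheory.Automorphic.UnitaryGroup AdelicGroupData
open Summit.HodgeConjecture.HodgeConjecture.Cruxes.H413.K2E1BorelEisensteinU
open Summit.HodgeConjecture.HodgeConjecture.Cruxes.H413.K2E1IntertwiningGrowthU3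
open Summit.HodgeConjecture.HodgeConjecture.Cruxes.H413.K2E1BorelHeightWeylUnipotent (borelHeight_weylLongU_coe_mul_mul_borelHeight_le_one)
open Summit.HodgeConjecture.HodgeConjecture.Cruxes.H413.K2E1HeightFunctionU3 (borelHeight_one)
open Summit.HodgeConjecture.HodgeConjecture.Cruxes.H413.K2E1BorelEisensteinRegularCMThree (rpow_le_rpow_add_rpow)
open Summit.HodgeConjecture.HodgeConjecture.Cruxes.H413.K2E1EisensteinAnalyticBinders (hfin_of_locallyUniformMajorant)
open Summit.HodgeConjecture.HodgeConjecture.Cruxes.H413.K2E1BorelEisensteinGodementCMThree (exists_locallyUniform_majorant_flatSectionU_cm_three)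
open Summit.HodgeConjecture.HodgeConjecture.Cruxes.H413.K2E1BorelCosetsDictionary (forall_arithmeticBorel_iff)
open Summit.HodgeConjecture.HodgeConjecture.Cruxes.H413.K2E1MaassSelbergBracketsThree (measurable_flatSectionU)
open Summit.HodgeConjecture.HodgeConjecture.Cruxes.H413.K2E1MaassSelbergDiagonalCMThree (continuousWithinAt_integral_mul_conj_of_bound)

namespace Summit.HodgeConjecture.HodgeConjecture.Cruxes.H413.K2E1IntertwinedCoeffContinuousCM

/-! ## §1 Generic quadratic `(F, E, c)`, `U(J₃)`: the intertwining integral and the intertwined coefficient are continuous in `z`; the uniform bound -/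

section Generic

variable {F E : Type} [Field F] [NumberField F] [Field E] [NumberField E] [Algebra F E] {c : E ≃ₐ[F] E}
variable [MeasurableSpace (quasiSplit F E c 3).Adelic] [BorelSpace (quasiSplit F E c 3).Adelic]

omit [MeasurableSpace (quasiSplit F E c 3).Adelic] [BorelSpace (quasiSplit F E c 3).Adelic] in
/-- `z ↦ f_z(x) = φ(x)·H(x)^z` is continuous (indeed entire) for every `x` (positive real base). [cite: MoeglinWaldspurger1995, II.1.5] -/
theorem continuous_flatSectionU_param (φ : (quasiSplit F E c 3).Adelic → ℂ) (x : (quasiSplit F E c 3).Adelic) : Continuous fun z : ℂ => flatSectionU φ z x := by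
  have hne : ((borelHeight x : ℝ) : ℂ) ≠ 0 := by exact_mod_cast (borelHeight_pos x).ne'
  simp only [flatSectionU_apply]
  exact continuous_const.mul (continuous_id.const_cpow (Or.inl hne))

omit [MeasurableSpace (quasiSplit F E c 3).Adelic] [BorelSpace (quasiSplit F E c 3).Adelic] in
/-- On the strip `σ₁ ≤ Re z ≤ σ₂`: `‖f_z(x)‖ ≤ C_φ·(H(x)^{σ₁} + H(x)^{σ₂})` (`‖f_z(x)‖ = ‖φ x‖·H(x)^{Re z}`, ★ `rpow_le_rpow_add_rpow`). [cite: MoeglinWaldspurger1995, II.1.5] -/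
theorem norm_flatSectionU_le_of_mem_strip {φ : (quasiSplit F E c 3).Adelic → ℂ} {Cφ : ℝ} (hφC : ∀ x, ‖φ x‖ ≤ Cφ) {σ₁ σ₂ : ℝ} {z : ℂ} (h₁ : σ₁ ≤ z.re) (h₂ : z.re ≤ σ₂)
    (x : (quasiSplit F E c 3).Adelic) : ‖flatSectionU φ z x‖ ≤ Cφ * ((borelHeight x : ℝ) ^ σ₁ + (borelHeight x : ℝ) ^ σ₂) := by
  have hpos : (0 : ℝ) < (borelHeight x : ℝ) := by exact_mod_cast borelHeight_pos x
  rw [norm_flatSectionU]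
  exact mul_le_mul (hφC x) (rpow_le_rpow_add_rpow hpos h₁ h₂) (Real.rpow_nonneg hpos.le _) ((norm_nonneg _).trans (hφC x))

/-- **THE INTERTWINING INTEGRAL `z ↦ ∫_{N(𝔸)} f_z(w₀ v g) dν` IS CONTINUOUS ON `{Re z > σ₀}`** (`φ` Borel with `‖φ‖ ≤ C_φ`) as soon as `v ↦ H(w₀ v g)^σ ∈ L¹(ν)` for every `σ > σ₀`:
dominated convergence on the strip `σ₁ < Re z < σ₂` around each point with the bound `C_φ·(H^{σ₁} + H^{σ₂})`. [cite: MoeglinWaldspurger1995, II.1.6] [cite: Garrett2018, §2.8] -/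
theorem continuousOn_intertwiningIntegral_flatSectionU_three (ν : Measure ↥(adelicUnipotent F E c 3)) {φ : (quasiSplit F E c 3).Adelic → ℂ} (hφm : Measurable φ) {Cφ : ℝ}
    (hφC : ∀ x, ‖φ x‖ ≤ Cφ) (g : (quasiSplit F E c 3).Adelic) {σ₀ : ℝ}
    (hint : ∀ σ : ℝ, σ₀ < σ → Integrable (fun v : ↥(adelicUnipotent F E c 3) =>
      (borelHeight ((quasiSplit F E c 3).toAdelic (weylLongU (c : E →+* E) (rfl : (StdForm.antidiagonal 3).over E = (StdForm.antidiagonal 3).over E)) * ((v : (quasiSplit F E c 3).Adelic) * g)) : ℝ) ^ σ) ν) :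
    ContinuousOn (fun z : ℂ => ∫ v : ↥(adelicUnipotent F E c 3),
      flatSectionU φ z ((quasiSplit F E c 3).toAdelic (weylLongU (c : E →+* E) (rfl : (StdForm.antidiagonal 3).over E = (StdForm.antidiagonal 3).over E)) * ((v : (quasiSplit F E c 3).Adelic) * g)) ∂ν)
      {z : ℂ | σ₀ < z.re} := by
  intro z₀ hz₀
  refine ContinuousAt.continuousWithinAt ?_
  have hz₀' : σ₀ < z₀.re := hz₀
  -- the strip around `Re z₀`
  set σ₁ : ℝ := (σ₀ + z₀.re) / 2 with hσ₁
  set σ₂ : ℝ := z₀.re + 1 with hσ₂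
  have h01 : σ₀ < σ₁ := by rw [hσ₁]; linarith
  have h1z : σ₁ < z₀.re := by rw [hσ₁]; linarith
  have hz2 : z₀.re < σ₂ := by rw [hσ₂]; linarith
  have h02 : σ₀ < σ₂ := h01.trans (h1z.trans hz2)
  have hstrip : {w : ℂ | σ₁ < w.re ∧ w.re < σ₂} ∈ 𝓝 z₀ := (isOpen_Ioo.preimage Complex.continuous_re).mem_nhds ⟨h1z, hz2⟩
  have hCφ : 0 ≤ Cφ := (norm_nonneg _).trans (hφC 1)
  have hwm : Measurable fun v : ↥(adelicUnipotent F E c 3) =>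
      (quasiSplit F E c 3).toAdelic (weylLongU (c : E →+* E) (rfl : (StdForm.antidiagonal 3).over E = (StdForm.antidiagonal 3).over E)) * ((v : (quasiSplit F E c 3).Adelic) * g) :=
    (continuous_const.mul (continuous_subtype_val.mul continuous_const)).measurable
  refine continuousAt_of_dominated (bound := fun v => Cφ * ((borelHeight ((quasiSplit F E c 3).toAdelic (weylLongU (c : E →+* E) (rfl : (StdForm.antidiagonal 3).over E = (StdForm.antidiagonal 3).over E)) *
      ((v : (quasiSplit F E c 3).Adelic) * g)) : ℝ) ^ σ₁ + (borelHeight ((quasiSplit F E c 3).toAdelic (weylLongU (c : E →+* E) (rfl : (StdForm.antidiagonal 3).over E = (StdForm.antidiagonal 3).over E)) *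
      ((v : (quasiSplit F E c 3).Adelic) * g)) : ℝ) ^ σ₂)) ?_ ?_ (((hint σ₁ h01).add (hint σ₂ h02)).const_mul Cφ) ?_
  · exact Eventually.of_forall fun z => ((measurable_flatSectionU hφm z).comp hwm).aestronglyMeasurable
  · filter_upwards [hstrip] with z hz
    exact ae_of_all _ fun v => norm_flatSectionU_le_of_mem_strip hφC hz.1.le hz.2.le _
  · exact ae_of_all _ fun v => (continuous_flatSectionU_param φ _).continuousAt

/-- **THE INTERTWINED COEFFICIENT `z ↦ φ̃_z(g) = (∫_{N(𝔸)} f_z(w₀ v g) dν)·H(g)^{z−2}` IS CONTINUOUS ON `{Re z > σ₀}`** (ED. 5 currency; §1 times an entire factor).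
[cite: MoeglinWaldspurger1995, II.1.6–II.1.7] [cite: Garrett2018, §2.8] -/
theorem continuousOn_intertwinedCoeff_flatSectionU_three (ν : Measure ↥(adelicUnipotent F E c 3)) {φ : (quasiSplit F E c 3).Adelic → ℂ} (hφm : Measurable φ) {Cφ : ℝ}
    (hφC : ∀ x, ‖φ x‖ ≤ Cφ) (g : (quasiSplit F E c 3).Adelic) {σ₀ : ℝ}
    (hint : ∀ σ : ℝ, σ₀ < σ → Integrable (fun v : ↥(adelicUnipotent F E c 3) =>
      (borelHeight ((quasiSplit F E c 3).toAdelic (weylLongU (c : E →+* E) (rfl : (StdForm.antidiagonal 3).over E = (StdForm.antidiagonal 3).over E)) * ((v : (quasiSplit F E c 3).Adelic) * g)) : ℝ) ^ σ) ν) :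
    ContinuousOn (fun z : ℂ => (∫ v : ↥(adelicUnipotent F E c 3),
      flatSectionU φ z ((quasiSplit F E c 3).toAdelic (weylLongU (c : E →+* E) (rfl : (StdForm.antidiagonal 3).over E = (StdForm.antidiagonal 3).over E)) * ((v : (quasiSplit F E c 3).Adelic) * g)) ∂ν) *
        ((borelHeight g : ℝ) : ℂ) ^ (z - 2)) {z : ℂ | σ₀ < z.re} := by
  have hne : ((borelHeight g : ℝ) : ℂ) ≠ 0 := by exact_mod_cast (borelHeight_pos g).ne'
  exact (continuousOn_intertwiningIntegral_flatSectionU_three ν hφm hφC g hint).mul ((continuous_id.sub continuous_const).const_cpow (Or.inl hne)).continuousOn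

omit [MeasurableSpace (quasiSplit F E c 3).Adelic] [BorelSpace (quasiSplit F E c 3).Adelic] in
/-- `H(w₀ v) ≤ 1` for every `v ∈ N(𝔸)` (★ R6a `H(w₀ v g)·H(g) ≤ 1` at `g = 1`, ★ `H(1) = 1`). [cite: Garrett2018, §1.5 and §2.3] -/
theorem borelHeight_weylLongU_coe_le_one (v : ↥(adelicUnipotent F E c 3)) :
    borelHeight ((quasiSplit F E c 3).toAdelic (weylLongU (c : E →+* E) (rfl : (StdForm.antidiagonal 3).over E = (StdForm.antidiagonal 3).over E)) * (v : (quasiSplit F E c 3).Adelic)) ≤ 1 := by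
  have h := borelHeight_weylLongU_coe_mul_mul_borelHeight_le_one v (1 : (quasiSplit F E c 3).Adelic)
  rwa [mul_one, borelHeight_one, mul_one] at h

omit [BorelSpace (quasiSplit F E c 3).Adelic] in
/-- **`c(σ)` IS NON-INCREASING**: for `σ₁ ≤ σ`, `∫ H(w₀ v)^σ dν ≤ ∫ H(w₀ v)^{σ₁} dν` (`H(w₀ v) ≤ 1`; the right side integrable, the left side's Bochner junk `0` is harmless).
[cite: MoeglinWaldspurger1995, II.1.6] [cite: Garrett2018, §2.8] -/
theorem integral_borelHeight_weylLongU_rpow_anti (ν : Measure ↥(adelicUnipotent F E c 3)) {σ₁ σ : ℝ} (hσ : σ₁ ≤ σ)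
    (hint₁ : Integrable (fun v : ↥(adelicUnipotent F E c 3) =>
      (borelHeight ((quasiSplit F E c 3).toAdelic (weylLongU (c : E →+* E) (rfl : (StdForm.antidiagonal 3).over E = (StdForm.antidiagonal 3).over E)) * (v : (quasiSplit F E c 3).Adelic)) : ℝ) ^ σ₁) ν) :
    ∫ v : ↥(adelicUnipotent F E c 3), (borelHeight ((quasiSplit F E c 3).toAdelic (weylLongU (c : E →+* E) (rfl : (StdForm.antidiagonal 3).over E = (StdForm.antidiagonal 3).over E)) * (v : (quasiSplit F E c 3).Adelic)) : ℝ) ^ σ ∂ν ≤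
      ∫ v : ↥(adelicUnipotent F E c 3), (borelHeight ((quasiSplit F E c 3).toAdelic (weylLongU (c : E →+* E) (rfl : (StdForm.antidiagonal 3).over E = (StdForm.antidiagonal 3).over E)) * (v : (quasiSplit F E c 3).Adelic)) : ℝ) ^ σ₁ ∂ν := by
  refine integral_mono_of_nonneg (ae_of_all _ fun v => Real.rpow_nonneg (NNReal.coe_nonneg _) _) hint₁ (ae_of_all _ fun v => ?_)
  have h0 : (0 : ℝ) < (borelHeight ((quasiSplit F E c 3).toAdelic (weylLongU (c : E →+* E) (rfl : (StdForm.antidiagonal 3).over E = (StdForm.antidiagonal 3).over E)) * (v : (quasiSplit F E c 3).Adelic)) : ℝ) := by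
    exact_mod_cast borelHeight_pos _
  have h1 : (borelHeight ((quasiSplit F E c 3).toAdelic (weylLongU (c : E →+* E) (rfl : (StdForm.antidiagonal 3).over E = (StdForm.antidiagonal 3).over E)) * (v : (quasiSplit F E c 3).Adelic)) : ℝ) ≤ 1 := by
    exact_mod_cast borelHeight_weylLongU_coe_le_one v
  exact Real.rpow_le_rpow_of_exponent_ge h0 h1 hσ

/-- **THE z-UNIFORM BOUND OF THE INTERTWINED COEFFICIENT**: for `σ₁ ≤ Re z`, `‖φ̃_z(g)‖ ≤ C_φ·c(σ₁)` with `c(σ₁) = ∫ H(w₀ v)^{σ₁} dν` INDEPENDENT OF `z` AND `g` — ★ [D8] §5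
`norm_intertwinedCoeff_le` (`≤ C_φ·c(Re z)`, under the Godement finiteness `hfin` at `(z, g)`) and `c(Re z) ≤ c(σ₁)`. [cite: MoeglinWaldspurger1995, II.1.6–II.1.7] [cite: Garrett2018, §2.8] -/
theorem norm_intertwinedCoeff_le_uniform_three (hc : c * c = 1) (hc1 : c ≠ 1) (ν : Measure ↥(adelicUnipotent F E c 3)) [ν.IsHaarMeasure] [ν.IsInvInvariant]
    (hBK : ∀ g : (quasiSplit F E c 3).Adelic, ∃ b ∈ borelAdelic F E c 3, ∃ k : (quasiSplit F E c 3).Adelic, adelicVal F E c 3 ((StdForm.antidiagonal 3).over E) k ∈ standardMaximalCompactGL 3 E ∧ g = b * k)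
    {𝓕 : Set ↥(adelicUnipotent F E c 3)} (h𝓕N : IsFundamentalDomain ↥(rationalUnipotent F E c 3) 𝓕 ν)
    {φ : (quasiSplit F E c 3).Adelic → ℂ} {Cφ : ℝ} (hφC : ∀ x, ‖φ x‖ ≤ Cφ) {σ₁ : ℝ}
    (hint₁ : Integrable (fun v : ↥(adelicUnipotent F E c 3) =>
      (borelHeight ((quasiSplit F E c 3).toAdelic (weylLongU (c : E →+* E) (rfl : (StdForm.antidiagonal 3).over E = (StdForm.antidiagonal 3).over E)) * (v : (quasiSplit F E c 3).Adelic)) : ℝ) ^ σ₁) ν)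
    {z : ℂ} (hz : σ₁ ≤ z.re) (g : (quasiSplit F E c 3).Adelic)
    (hfin : ∫⁻ u in 𝓕, (∑' q : (quasiSplit F E c 3).quotientSubgroup ⧸ (borelAdelic F E c 3).subgroupOf (quasiSplit F E c 3).quotientSubgroup,
        ‖flatSectionU (fun _ : (quasiSplit F E c 3).Adelic => (1 : ℂ)) z ((((q.out : (quasiSplit F E c 3).quotientSubgroup) : (quasiSplit F E c 3).Adelic))⁻¹ * (u : (quasiSplit F E c 3).Adelic) * g)‖ₑ) ∂ν < ∞) :
    ‖(∫ v : ↥(adelicUnipotent F E c 3), flatSectionU φ z ((quasiSplit F E c 3).toAdelic (weylLongU (c : E →+* E) (rfl : (StdForm.antidiagonal 3).over E = (StdForm.antidiagonal 3).over E)) * ((v : (quasiSplit F E c 3).Adelic) * g)) ∂ν) *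
        ((borelHeight g : ℝ) : ℂ) ^ (z - 2)‖ ≤
      Cφ * ∫ v : ↥(adelicUnipotent F E c 3), (borelHeight ((quasiSplit F E c 3).toAdelic (weylLongU (c : E →+* E) (rfl : (StdForm.antidiagonal 3).over E = (StdForm.antidiagonal 3).over E)) * (v : (quasiSplit F E c 3).Adelic)) : ℝ) ^ σ₁ ∂ν := by
  have hCφ : 0 ≤ Cφ := (norm_nonneg _).trans (hφC 1)
  have h5 := norm_intertwinedCoeff_le hc hc1 ν hBK h𝓕N hφC z g hfin
  exact h5.trans (mul_le_mul_of_nonneg_left (integral_borelHeight_weylLongU_rpow_anti ν hz hint₁) hCφ)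

end Generic

/-! ## §2 The two outer layers of a bracket `[Ξ](p)`: the `K_U`-average and the idele-class integral (generic dominated convergence) -/

section Layers

variable {X : Type*} [MeasurableSpace X] {P : Type*} [TopologicalSpace P] [FirstCountableTopology P]

/-- **THE `K_U`-LAYER**: `p ↦ ∫_K α·conj (β_p) dμ_K` is continuous (within `S`, at `p₀`) on a FINITE measure space when `α` is bounded a.e.-strongly measurable, the `β_p` are
a.e.-strongly measurable and uniformly bounded near `p₀` (§1's z-uniform bound), and `p ↦ β_p(k)` is continuous for a.e. `k` (§1's continuity) — ★ p857918 §1, re-exported in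
`K_U`-currency. [cite: MoeglinWaldspurger1995, IV.2.3] [cite: Arthur1980TraceFormulaII, §4] -/
theorem continuousWithinAt_average_mul_conj_of_bound (μK : Measure X) [IsFiniteMeasure μK] {α : X → ℂ} {β : P → X → ℂ} {S : Set P} {p₀ : P}
    (hαm : AEStronglyMeasurable α μK) {Cα : ℝ} (hα : ∀ k, ‖α k‖ ≤ Cα)
    (hβm : ∀ᶠ p in 𝓝[S] p₀, AEStronglyMeasurable (β p) μK) {Cβ : ℝ} (hβ : ∀ᶠ p in 𝓝[S] p₀, ∀ k, ‖β p k‖ ≤ Cβ)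
    (hcont : ∀ᵐ k ∂μK, ContinuousWithinAt (fun p => β p k) S p₀) :
    ContinuousWithinAt (fun p => ∫ k, α k * conj (β p k) ∂μK) S p₀ :=
  continuousWithinAt_integral_mul_conj_of_bound μK hαm hα hβm hβ hcont

/-- **THE IDELE-CLASS LAYER**: `p ↦ ∫_S ↑w·Ξ_p dν` is continuous (within `S′`, at `p₀`) when `ν S < ∞`, the real weight `w` is a.e.-strongly measurable with `|w| ≤ W` (on
`S = 𝓕_I ∩ {‖x‖ ≤ 1}`: `w = ‖x‖ ≤ 1`, ★ Tate finiteness of `ν_I(S)`), the `Ξ_p` are a.e.-strongly measurable on `S` and uniformly bounded near `p₀`, and `p ↦ Ξ_p(x)` is continuous for a.e.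
`x ∈ S` — dominated convergence over the finite measure `ν|_S` with the constant bound `W·C`. [cite: MoeglinWaldspurger1995, IV.2.3] [cite: Arthur1980TraceFormulaII, §4] -/
theorem continuousWithinAt_setIntegral_ofReal_mul_of_bound (ν : Measure X) {S : Set X} (hS : ν S ≠ ∞) {w : X → ℝ} (hwm : AEStronglyMeasurable w (ν.restrict S)) {W : ℝ}
    (hw : ∀ x, |w x| ≤ W) {Ξ : P → X → ℂ} {S' : Set P} {p₀ : P}
    (hΞm : ∀ᶠ p in 𝓝[S'] p₀, AEStronglyMeasurable (Ξ p) (ν.restrict S)) {C : ℝ} (hΞ : ∀ᶠ p in 𝓝[S'] p₀, ∀ x, ‖Ξ p x‖ ≤ C)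
    (hcont : ∀ᵐ x ∂(ν.restrict S), ContinuousWithinAt (fun p => Ξ p x) S' p₀) :
    ContinuousWithinAt (fun p => ∫ x in S, (w x : ℂ) * Ξ p x ∂ν) S' p₀ := by
  haveI : IsFiniteMeasure (ν.restrict S) := isFiniteMeasure_restrict.2 hS
  refine continuousWithinAt_of_dominated (bound := fun _ => W * C) ?_ ?_ (integrable_const _) ?_
  · filter_upwards [hΞm] with p hpm
    exact (Complex.continuous_ofReal.comp_aestronglyMeasurable hwm).mul hpm
  · filter_upwards [hΞ] with p hpC
    exact ae_of_all _ fun x => by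
      rw [norm_mul, Complex.norm_real, Real.norm_eq_abs]
      exact mul_le_mul (hw x) (hpC x) (norm_nonneg _) ((abs_nonneg _).trans (hw x))
  · filter_upwards [hcont] with x hx
    exact continuousWithinAt_const.mul hx

end Layers

/-! ## §3 The CM pair `(L⁺, L, conj)`: `hint` and `hfin` DISCHARGED (fundamental domain of compact closure), continuity on `{Re z > 2}`, uniform bound on `{Re z ≥ σ₁}` -/

section CM

variable (L : Type) [Field L] [NumberField L] [IsCMField L]
variable [MeasurableSpace (quasiSplit (↥(maximalRealSubfield L)) L (IsCMField.complexConj L) 3).Adelic] [BorelSpace (quasiSplit (↥(maximalRealSubfield L)) L (IsCMField.complexConj L) 3).Adelic]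

/-- **GODEMENT FINITENESS OF THE STANDARD SECTION `H^w`, `Re w > 2`, AT EVERY `g`** (★ R3's spelling; the CM road of ★ CM-FINAL: ★ `hfin_of_locallyUniformMajorant` ∘ ★ R4a majorant
`exists_locallyUniform_majorant_flatSectionU_cm_three`, `𝓕` of COMPACT CLOSURE, any `ν` finite on compacts). [cite: MoeglinWaldspurger1995, II.1.5–II.1.6] [cite: Godement1964, §1.1] -/
theorem lintegral_flatSectionU_one_lt_top_cm_three (ν : Measure ↥(adelicUnipotent (↥(maximalRealSubfield L)) L (IsCMField.complexConj L) 3)) [IsFiniteMeasureOnCompacts ν]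
    {𝓕 : Set ↥(adelicUnipotent (↥(maximalRealSubfield L)) L (IsCMField.complexConj L) 3)} (h𝓕c : IsCompact (closure 𝓕)) {w : ℂ} (hw : 2 < w.re)
    (g : (quasiSplit (↥(maximalRealSubfield L)) L (IsCMField.complexConj L) 3).Adelic) :
    ∫⁻ u in 𝓕, (∑' q : (quasiSplit (↥(maximalRealSubfield L)) L (IsCMField.complexConj L) 3).quotientSubgroup ⧸
        (borelAdelic (↥(maximalRealSubfield L)) L (IsCMField.complexConj L) 3).subgroupOf (quasiSplit (↥(maximalRealSubfield L)) L (IsCMField.complexConj L) 3).quotientSubgroup,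
      ‖flatSectionU (fun _ : (quasiSplit (↥(maximalRealSubfield L)) L (IsCMField.complexConj L) 3).Adelic => (1 : ℂ)) w
        ((((q.out : (quasiSplit (↥(maximalRealSubfield L)) L (IsCMField.complexConj L) 3).quotientSubgroup) : (quasiSplit (↥(maximalRealSubfield L)) L (IsCMField.complexConj L) 3).Adelic))⁻¹ *
          (u : (quasiSplit (↥(maximalRealSubfield L)) L (IsCMField.complexConj L) 3).Adelic) * g)‖ₑ) ∂ν < ∞ := by
  haveI := t2Space_adeleRing_of_numberField L
  haveI : T2Space (quasiSplit (↥(maximalRealSubfield L)) L (IsCMField.complexConj L) 3).Adelic :=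
    inferInstanceAs (T2Space (adelic (↥(maximalRealSubfield L)) L (IsCMField.complexConj L) 3 ((StdForm.antidiagonal 3).over L)))
  have hstdB : ∀ b ∈ borelU ((IsCMField.complexConj L : L ≃ₐ[↥(maximalRealSubfield L)] L) : L →+* L) ((StdForm.antidiagonal 3).over L),
      ∀ x : (quasiSplit (↥(maximalRealSubfield L)) L (IsCMField.complexConj L) 3).Adelic,
        flatSectionU (fun _ : (quasiSplit (↥(maximalRealSubfield L)) L (IsCMField.complexConj L) 3).Adelic => (1 : ℂ)) w ((quasiSplit (↥(maximalRealSubfield L)) L (IsCMField.complexConj L) 3).toAdelic b * x) =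
          flatSectionU (fun _ : (quasiSplit (↥(maximalRealSubfield L)) L (IsCMField.complexConj L) 3).Adelic => (1 : ℂ)) w x :=
    forall_arithmeticBorel_iff.1 fun b hb x => by rw [flatSectionU_apply, flatSectionU_apply, borelHeight_arithmeticBorel_mul hb]
  exact hfin_of_locallyUniformMajorant ν hstdB (fun q => (continuous_flatSectionU continuous_const w).comp (continuous_const.mul continuous_id))
    (exists_locallyUniform_majorant_flatSectionU_cm_three L hw (M := 1) (fun x => by rw [norm_one])) h𝓕c g

/-- **`hint` AT THE CM PAIR**: `v ↦ H(w₀ v g)^σ ∈ L¹(ν)` for every real `σ > 2` and every `g` (★ [D8] §4 `integrable_borelHeight_weylLongU_mul_rpow` at `z = σ` ∘ the Godement finiteness above;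
`ν` an inversion-invariant Haar measure, `𝓕` a fundamental domain of `N(L⁺)` of compact closure). [cite: MoeglinWaldspurger1995, II.1.6] [cite: Godement1964, §1.1] -/
theorem integrable_borelHeight_weylLongU_mul_rpow_cm_three (ν : Measure ↥(adelicUnipotent (↥(maximalRealSubfield L)) L (IsCMField.complexConj L) 3)) [ν.IsHaarMeasure] [ν.IsInvInvariant]
    {𝓕 : Set ↥(adelicUnipotent (↥(maximalRealSubfield L)) L (IsCMField.complexConj L) 3)}
    (h𝓕N : IsFundamentalDomain ↥(rationalUnipotent (↥(maximalRealSubfield L)) L (IsCMField.complexConj L) 3) 𝓕 ν) (h𝓕c : IsCompact (closure 𝓕)) {σ : ℝ} (hσ : 2 < σ)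
    (g : (quasiSplit (↥(maximalRealSubfield L)) L (IsCMField.complexConj L) 3).Adelic) :
    Integrable (fun v : ↥(adelicUnipotent (↥(maximalRealSubfield L)) L (IsCMField.complexConj L) 3) =>
      (borelHeight ((quasiSplit (↥(maximalRealSubfield L)) L (IsCMField.complexConj L) 3).toAdelic
        (weylLongU ((IsCMField.complexConj L : L ≃ₐ[↥(maximalRealSubfield L)] L) : L →+* L) (rfl : (StdForm.antidiagonal 3).over L = (StdForm.antidiagonal 3).over L)) *
          ((v : (quasiSplit (↥(maximalRealSubfield L)) L (IsCMField.complexConj L) 3).Adelic) * g)) : ℝ) ^ σ) ν := by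
  have h := integrable_borelHeight_weylLongU_mul_rpow ν h𝓕N (σ : ℂ) g (lintegral_flatSectionU_one_lt_top_cm_three L ν h𝓕c (w := (σ : ℂ)) (by rwa [Complex.ofReal_re]) g)
  simpa only [Complex.ofReal_re] using h

/-- **THE INTERTWINED COEFFICIENT IS CONTINUOUS IN `z` ON `{Re z > 2}` AT THE CM PAIR** (every `g`; `φ` continuous with `‖φ‖ ≤ C_φ`; `ν` inversion-invariant Haar, `𝓕` a fundamental
domain of `N(L⁺)` of compact closure): §1 with `hint` discharged above. [cite: MoeglinWaldspurger1995, II.1.6–II.1.7] [cite: Garrett2018, §2.8] -/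
theorem continuousOn_intertwinedCoeff_flatSectionU_cm_three (ν : Measure ↥(adelicUnipotent (↥(maximalRealSubfield L)) L (IsCMField.complexConj L) 3)) [ν.IsHaarMeasure] [ν.IsInvInvariant]
    {𝓕 : Set ↥(adelicUnipotent (↥(maximalRealSubfield L)) L (IsCMField.complexConj L) 3)}
    (h𝓕N : IsFundamentalDomain ↥(rationalUnipotent (↥(maximalRealSubfield L)) L (IsCMField.complexConj L) 3) 𝓕 ν) (h𝓕c : IsCompact (closure 𝓕))
    {φ : (quasiSplit (↥(maximalRealSubfield L)) L (IsCMField.complexConj L) 3).Adelic → ℂ} (hφc : Continuous φ) {Cφ : ℝ} (hφC : ∀ x, ‖φ x‖ ≤ Cφ)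
    (g : (quasiSplit (↥(maximalRealSubfield L)) L (IsCMField.complexConj L) 3).Adelic) :
    ContinuousOn (fun z : ℂ => (∫ v : ↥(adelicUnipotent (↥(maximalRealSubfield L)) L (IsCMField.complexConj L) 3),
        flatSectionU φ z ((quasiSplit (↥(maximalRealSubfield L)) L (IsCMField.complexConj L) 3).toAdelic
          (weylLongU ((IsCMField.complexConj L : L ≃ₐ[↥(maximalRealSubfield L)] L) : L →+* L) (rfl : (StdForm.antidiagonal 3).over L = (StdForm.antidiagonal 3).over L)) *
            ((v : (quasiSplit (↥(maximalRealSubfield L)) L (IsCMField.complexConj L) 3).Adelic) * g)) ∂ν) *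
      ((borelHeight g : ℝ) : ℂ) ^ (z - 2)) {z : ℂ | 2 < z.re} :=
  continuousOn_intertwinedCoeff_flatSectionU_three ν hφc.measurable hφC g fun _ hσ => integrable_borelHeight_weylLongU_mul_rpow_cm_three L ν h𝓕N h𝓕c hσ g

/-- **THE z-UNIFORM BOUND AT THE CM PAIR**: for `2 < σ₁ ≤ Re z` and every `g`, `‖φ̃_z(g)‖ ≤ C_φ·c(σ₁)`, `c(σ₁) = ∫ H(w₀ v)^{σ₁} dν < ∞` — no named input (Iwasawa ★, `conj² = 1 ≠ conj`,
`hfin` and `hint₁` by the CM road above). [cite: MoeglinWaldspurger1995, II.1.6–II.1.7] [cite: Garrett2018, §2.8] -/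
theorem norm_intertwinedCoeff_le_uniform_cm_three (ν : Measure ↥(adelicUnipotent (↥(maximalRealSubfield L)) L (IsCMField.complexConj L) 3)) [ν.IsHaarMeasure] [ν.IsInvInvariant]
    {𝓕 : Set ↥(adelicUnipotent (↥(maximalRealSubfield L)) L (IsCMField.complexConj L) 3)}
    (h𝓕N : IsFundamentalDomain ↥(rationalUnipotent (↥(maximalRealSubfield L)) L (IsCMField.complexConj L) 3) 𝓕 ν) (h𝓕c : IsCompact (closure 𝓕))
    {φ : (quasiSplit (↥(maximalRealSubfield L)) L (IsCMField.complexConj L) 3).Adelic → ℂ} {Cφ : ℝ} (hφC : ∀ x, ‖φ x‖ ≤ Cφ)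
    {σ₁ : ℝ} (hσ₁ : 2 < σ₁) {z : ℂ} (hz : σ₁ ≤ z.re) (g : (quasiSplit (↥(maximalRealSubfield L)) L (IsCMField.complexConj L) 3).Adelic) :
    ‖(∫ v : ↥(adelicUnipotent (↥(maximalRealSubfield L)) L (IsCMField.complexConj L) 3),
        flatSectionU φ z ((quasiSplit (↥(maximalRealSubfield L)) L (IsCMField.complexConj L) 3).toAdelic
          (weylLongU ((IsCMField.complexConj L : L ≃ₐ[↥(maximalRealSubfield L)] L) : L →+* L) (rfl : (StdForm.antidiagonal 3).over L = (StdForm.antidiagonal 3).over L)) *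
            ((v : (quasiSplit (↥(maximalRealSubfield L)) L (IsCMField.complexConj L) 3).Adelic) * g)) ∂ν) *
        ((borelHeight g : ℝ) : ℂ) ^ (z - 2)‖ ≤
      Cφ * ∫ v : ↥(adelicUnipotent (↥(maximalRealSubfield L)) L (IsCMField.complexConj L) 3),
        (borelHeight ((quasiSplit (↥(maximalRealSubfield L)) L (IsCMField.complexConj L) 3).toAdelic
          (weylLongU ((IsCMField.complexConj L : L ≃ₐ[↥(maximalRealSubfield L)] L) : L →+* L) (rfl : (StdForm.antidiagonal 3).over L = (StdForm.antidiagonal 3).over L)) *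
            (v : (quasiSplit (↥(maximalRealSubfield L)) L (IsCMField.complexConj L) 3).Adelic)) : ℝ) ^ σ₁ ∂ν := by
  have hint₁ := integrable_borelHeight_weylLongU_mul_rpow_cm_three L ν h𝓕N h𝓕c hσ₁ 1
  simp only [mul_one] at hint₁
  exact norm_intertwinedCoeff_le_uniform_three (AlgEquiv.ext fun x => IsCMField.complexConj_apply_apply L x) (IsCMField.complexConj_ne_one L) ν
    (exists_mem_borelAdelic_mul_mem_standardMaximalCompactGL_cm_three L) h𝓕N hφC hint₁ hz g
    (lintegral_flatSectionU_one_lt_top_cm_three L ν h𝓕c (lt_of_lt_of_le hσ₁ hz) g)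

end CM

end Summit.HodgeConjecture.HodgeConjecture.Cruxes.H413.K2E1IntertwinedCoeffContinuousCM

end
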